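import Literature.AlgebraicGeometry.AbelianSchemes.AbelianSchemeFiniteSubgroupTorsion
import HarnessLib

/-!
# A finite unramified closed subgroup subscheme whose fibre orders divide `N` is killed by `N` (the exponent of ★ (T3) exposed)

Layer `Literature/AlgebraicGeometry/AbelianSchemes`, namespace `Literature.AlgebraicGeometry.AbelianSchemes.AbelianSchemeOver`.
THEOREMS ONLY (no definition, no named fact, no instance, no notation, no `sorry`).  Cell `hodgecm-mathlib` (D-0151), sub-desk
P6b «BT groups & Serre–Tate» census (O9) `F0/P6/F0P6b-plan/g11/CENSUS-O9-polarisedKill.v1.F0P6b-plan-g11.md` brick **(O9a) = (T3′)**.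
HC_CM is proved only modulo the printed citations until rung 0 closes; nothing here is about HC.

SETTING (as ★ `AbelianSchemeFiniteSubgroupTorsion`).  `R` a ring, `A` an abelian scheme over `Spec R` (★ `AbelianSchemeOver`),
`i : Z ↪ A` a closed immersion over `Spec R` with `Z → Spec R` finite, through which the unit, the product of the two projections and
the inverse factor; at a field-valued point `t` the fibre `Z_t ⊆ A_t` is a ★ `FiniteSubgroupSubscheme` (★ `finiteSubgroupSubschemeFibre`)
of ORDER `dim_{κ} Γ(Z_t, 𝒪)` (★ `FiniteSubgroupSubscheme.order`).

* §1 **`pow_eq_one_of_forall_order_dvd`** — **(T3′)**: if `Z → Spec R` is formally unramified and the order of the fibre `Z_{κ(s)}`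
  through every point `z ∈ Z` (over `s ∈ Spec R`) DIVIDES `N`, then `i ^ N = 1` in `A(Z)`.  ★ (T3) `exists_pow_eq_one_of_formallyUnramified`
  proves `∃ n > 0, i ^ n = 1` by the same road but hides the exponent (a product over a finite subcover); here the factorisation `v_N` of
  `i ^ N` moves EVERY point into the (open, ★ `isOpenImmersion_left_of_section`) unit section at once — `v_N = v_{n(z)} ≫ v_{N / n(z)}`
  (★ `fac_comp_fac_comp`) and `v_{n(z)} z ∈ im e` by DELIGNE on the fibre (★ `fac_apply_mem_range_unit`, ★
  `FiniteSubgroupSubscheme.emb_pow_order`) — so `v_N` factors through `e` (Mathlib `IsOpenImmersion.lift`) and `i ^ N = v_N ≫ i = 1`.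
  No quasi-compactness is needed.  [MumfordAV1970] §13 (p. 123): `K(L) ⊆ X[n]`; [GortzWedhorn2023] Prop. 27.86.
* §2 **`pow_eq_one_of_order_dvd_of_forall_eq`** — over a base with ONE point `x₀` (e.g. `Spec` of an Artin local ring) a single
  divisibility «order of `Z_{κ(x₀)}` divides `N`» suffices; **`comp_pow_eq_one_of_order_dvd_of_forall_eq`** — then every `T`-valued point
  of `A` factoring through `Z` is killed by `N` (Mathlib `MonObj.comp_pow`).  This is the shape the lifting letter ★
  `AbelianSchemeOver.exists_abelianLift_of_isUnit_two_of_letter` (`hkill`) consumes.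

## References
* [MumfordAV1970] D. Mumford, *Abelian Varieties* (1970), §6 Application 3 (p. 64), §13 (p. 123).
* [GortzWedhorn2023] U. Görtz, T. Wedhorn, *Algebraic Geometry II* (2023), Prop. 27.86 (p. 633).
* [EGAIV4] A. Grothendieck, J. Dieudonné, *EGA IV₄* (1967), Cor. 17.4.2 (unramified ⇔ diagonal open).
-/

set_option autoImplicit false

noncomputable section

-- `TopCat.Presheaf`/`Scheme.Modules` are not reducible (as in ★ `AbelianSchemeFiniteSubgroupTorsion`).
set_option backward.isDefEq.respectTransparency false

open CategoryTheory CategoryTheory.Limits AlgebraicGeometry MonoidalCategory CartesianMonoidalCategory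

open scoped MonObj CategoryTheory.Obj

namespace Literature.AlgebraicGeometry.AbelianSchemes

open Literature.AlgebraicGeometry.Motives Literature.AlgebraicGeometry.Motives.AbelianVariety Literature.AlgebraicGeometry.Limits

namespace AbelianSchemeOver

variable {R : Type} [CommRing R] (A : AbelianSchemeOver (Spec (.of R)))

variable {Z : Over (Spec (.of R))} (i : Z ⟶ A.X) [IsClosedImmersion i.left] [IsFinite Z.hom]
  (he : ∃ e : 𝟙_ (Over (Spec (.of R))) ⟶ Z, e ≫ i = 1)
  (hm : ∃ m : Z ⊗ Z ⟶ Z, m ≫ i = (fst Z Z ≫ i) * (snd Z Z ≫ i))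
  (hn : ∃ n : Z ⟶ Z, n ≫ i = i⁻¹)

/-! ## §1 (T3′) `i ^ N = 1` when the fibre orders divide `N` -/

/-- **(T3′) A FINITE UNRAMIFIED CLOSED SUBGROUP SUBSCHEME WHOSE FIBRE ORDERS DIVIDE `N` IS KILLED BY `N`**: if `Z → Spec R` is
formally unramified and, for every point `z ∈ Z` over `s ∈ Spec R`, the order `dim_{κ(s)} Γ(Z_{κ(s)}, 𝒪)` of the fibre
`Z_{κ(s)} ⊆ A_{κ(s)}` divides `N`, then `i ^ N = 1` in `A(Z)`.  See the module docstring for the proof (open unit section, Deligne on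
the fibres — ★ (T3) with the exponent exposed). [cite: MumfordAV1970, §13 (p. 123)] [cite: GortzWedhorn2023, Prop. 27.86 (p. 633)]
[cite: EGAIV4, Cor. 17.4.2] -/
theorem pow_eq_one_of_forall_order_dvd [FormallyUnramified Z.hom] {N : ℕ}
    (hdvd : ∀ z : Z.left, (A.finiteSubgroupSubschemeFibre i he hm hn
      ((Spec (.of R)).fromSpecResidueField (Z.hom.base z))).order ∣ N) :
    i ^ N = 1 := by
  classical
  obtain ⟨e, he'⟩ := id he
  haveI : Mono i := A.mono_of_isClosedImmersion_left i
  haveI : IsOpenImmersion e.left := isOpenImmersion_left_of_section e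
  -- the factorisations `v m` of `i ^ m`
  choose v hv using A.exists_hom_comp_eq_pow i he hm
  -- every point is moved into the unit section by `v N`
  have hrange : Set.range (v N).left.base ⊆ Set.range e.left.base := by
    rintro _ ⟨z, rfl⟩
    obtain ⟨k, hk⟩ := hdvd z
    set m := (A.finiteSubgroupSubschemeFibre i he hm hn ((Spec (.of R)).fromSpecResidueField (Z.hom.base z))).order with hm'
    have hzm : (v m).left.base z ∈ Set.range e.left.base :=
      A.fac_apply_mem_range_unit i he hm hn e he' z (v m) (hv m)
    have hvN : v N = v m ≫ v k := by
      rw [← cancel_mono i, A.fac_comp_fac_comp i (v m) (v k) (hv m) (hv k), ← hk, hv N]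
    obtain ⟨x, hx⟩ := hzm
    have hek : e ≫ v k = e := by
      rw [← cancel_mono i, Category.assoc, A.unit_comp_fac_comp i e he' (v k) (hv k)]
    refine ⟨x, ?_⟩
    have hcomp : (e ≫ v k).left.base x = (v k).left.base (e.left.base x) := by
      rw [Over.comp_left, Scheme.Hom.comp_base, TopCat.comp_app]
    rw [hvN, Over.comp_left, Scheme.Hom.comp_base, TopCat.comp_app, ← hx, ← hcomp, hek]
  -- so `v N` factors through the open immersion `e`, i.e. `v N = (Z → Spec R) ≫ e`
  have h1 := IsOpenImmersion.lift_fac e.left (v N).left hrange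
  have hw : IsOpenImmersion.lift e.left (v N).left hrange ≫ (𝟙_ (Over (Spec (.of R)))).hom = Z.hom := by
    rw [← Over.w e, ← Category.assoc, h1, Over.w (v N)]
  have hwu : Over.homMk (IsOpenImmersion.lift e.left (v N).left hrange) hw = toUnit Z := toUnit_unique _ _
  have hvN : v N = toUnit Z ≫ e := by
    rw [← hwu]
    refine Over.OverMorphism.ext ?_
    rw [Over.comp_left]
    exact h1.symm
  rw [← hv N, hvN, Category.assoc, he', MonObj.comp_one]

/-! ## §2 Over a one-point base a single divisibility suffices; `T`-valued points -/

/-- **Over a base with one point** `x₀` (every `x ∈ Spec R` equals `x₀`, e.g. `R` Artin local): if `Z → Spec R` is formally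
unramified and the order of the fibre `Z_{κ(x₀)} ⊆ A_{κ(x₀)}` divides `N`, then `i ^ N = 1`.
[cite: MumfordAV1970, §13 (p. 123)] [cite: GortzWedhorn2023, Prop. 27.86 (p. 633)] -/
theorem pow_eq_one_of_order_dvd_of_forall_eq [FormallyUnramified Z.hom] {N : ℕ} (x₀ : Spec (.of R))
    (hx : ∀ x : Spec (.of R), x = x₀)
    (hdvd : (A.finiteSubgroupSubschemeFibre i he hm hn ((Spec (.of R)).fromSpecResidueField x₀)).order ∣ N) :
    i ^ N = 1 := by
  refine A.pow_eq_one_of_forall_order_dvd i he hm hn fun z => ?_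
  have hz : Z.hom.base z = x₀ := hx _
  rw [hz]
  exact hdvd

omit [IsClosedImmersion i.left] [IsFinite Z.hom] in
/-- **`T`-valued points of `A` factoring through a `Z` with `i ^ N = 1` are killed by `N`** (`(w ≫ i) ^ N = w ≫ i ^ N = w ≫ 1 = 1`,
Mathlib `MonObj.comp_pow` / `MonObj.comp_one`). [cite: MumfordAV1970, §13 (p. 123)] -/
theorem comp_pow_eq_one_of_pow_eq_one {N : ℕ} (hiN : i ^ N = 1) {T : Over (Spec (.of R))} (w : T ⟶ Z) :
    (w ≫ i) ^ N = 1 := by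
  rw [← MonObj.comp_pow, hiN, MonObj.comp_one]

/-- **Over a one-point base, every `T`-valued point of `A` through a finite unramified closed subgroup subscheme whose fibre order
divides `N` is killed by `N`** (§2 + `comp_pow_eq_one_of_pow_eq_one`) — the `hkill` shape of the lifting letter ★
`exists_abelianLift_of_isUnit_two_of_letter`. [cite: MumfordAV1970, §13 (p. 123)] [cite: GortzWedhorn2023, Prop. 27.86 (p. 633)] -/
theorem comp_pow_eq_one_of_order_dvd_of_forall_eq [FormallyUnramified Z.hom] {N : ℕ} (x₀ : Spec (.of R))
    (hx : ∀ x : Spec (.of R), x = x₀)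
    (hdvd : (A.finiteSubgroupSubschemeFibre i he hm hn ((Spec (.of R)).fromSpecResidueField x₀)).order ∣ N)
    {T : Over (Spec (.of R))} (u : T ⟶ A.X) (hu : ∃ w : T ⟶ Z, w ≫ i = u) :
    u ^ N = 1 := by
  obtain ⟨w, rfl⟩ := hu
  exact A.comp_pow_eq_one_of_pow_eq_one i (A.pow_eq_one_of_order_dvd_of_forall_eq i he hm hn x₀ hx hdvd) w

end AbelianSchemeOver

end Literature.AlgebraicGeometry.AbelianSchemes

end
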